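import Summits.BirchSwinnertonDyer.BirchSwinnertonDyer.Theorems.KolyvaginRoadThreeMethod2CruxOfOddRank
import Summits.BirchSwinnertonDyer.BirchSwinnertonDyer.Theorems.KolyvaginRoadThreeMethod2RankLoweringGood
import HarnessLib

/-!
# Route `KolyvaginRoadThree`, deciding crux `ZhangSharpFrameAtThreeHL` (item stmt-BirchSwinnertonDyer-19574):
# the crux BY NAME from the five good-prime local–global inputs of rank lowering + stub B + parity of dim Sel₃(E/K)
# (cell `bsd-stepL`, seat `bsd-stepL-koly3a` g0, ACCEL-LIST (9); `--supports stmt-BirchSwinnertonDyer-19574`, helper)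

HONEST FRAMING. CONDITIONAL composition; no definition, no named fact, no `sorry`; nothing is booked; the crux is NOT
claimed (the owner assembles). Sequel of `Theorems/KolyvaginRoadThreeMethod2CruxOfOddRank.lean` (crux ⟸ (A1 on good
levels) + stub B + (Par)), with (A1) replaced by its five named inputs at GOOD (non-scalar) unipotent-admissible primes
(`Method2.selQ_rankLowering_on_of_localGlobal`, `Theorems/KolyvaginRoadThreeMethod2RankLoweringGood.lean`). As of this
file the NAMED INPUTS of crux 19574 along the METHOD line are: (Cheb) Čebotarev with the sign rule producing a good
prime [W. Zhang 2014 Lemma 7.3 ∕ BD05 Thm 3.2 ∕ koly U3]; at good primes (Equiv) [Zhang (9.2)], (Line) [BD05 L.2.6 ∕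
koly U1], (Trans) [BD05 L.2.6 ∕ koly U4], (Iso) on good levels [Poitou–Tate; Zhang Prop 5.4]; (Par) `dim_𝔽₃ Sel₃(E/K)`
odd [GZ + Kolyvagin + Cassels–Tate on HL frames]; and the registered stub B (v2u). PARTITION: O2@3 (B10) × A1 × crux
19574 — none (conditional composition; closes nothing; T7).

References: [cite: WZhang2014, §9 proof of Thm. 9.1, Prop. 5.4, Lemma 7.3] [cite: BertoliniDarmon2005, Lemma 2.6, Thm. 3.2].
-/

noncomputable section

open scoped Classical

namespace Summit.BirchSwinnertonDyer.Rank1Residual.X11b.Three.Koly.Method2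

open WeierstrassCurve NumberField IsDedekindDomain
  Literature.NumberTheory.EllipticCurves Literature.NumberTheory.EllipticCurves.ModularForms
  Literature.NumberTheory.GaloisRepresentations Module

/-! ## §2 The crux from the five local–global inputs + stub B + parity -/

/-- **`ZhangSharpFrameAtThreeHL` BY NAME from the five local–global inputs of rank lowering ((Cheb), (Equiv),
(Line), (Trans), (Iso) at GOOD primes — `selQ_rankLowering_on_of_localGlobal`), stub B (v2u) as a hypothesis, and
the parity of
`dim_𝔽₃ Sel₃(E/K)`.** As of this theorem the NAMED INPUTS of crux 19574 along the METHOD line are: (Cheb) Čebotarev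
with the sign rule [Zhang L.7.3 ∕ BD05 Thm 3.2 ∕ koly U3]; (Equiv) scalar sign of complex conjugation on
`H¹(K_q, E[3])` [Zhang (9.2)]; (Line) the Kummer image at `q` is a line [BD05 L.2.6 ∕ koly U1]; (Trans)
Kummer ∩ ordinary = 0 at `q` [BD05 L.2.6 ∕ koly U4]; (Iso) Poitou–Tate isotropy at `q` [Zhang Prop 5.4]; (Par)
`dim_𝔽₃ Sel₃(E/K)` odd [GZ + Kolyvagin + Cassels–Tate on HL frames]; and stub B. CONDITIONAL; nothing is booked.
[cite: WZhang2014, §9 proof of Thm. 9.1, Prop. 5.4, Lemma 7.3] [cite: BertoliniDarmon2005, Lemma 2.6, Thm. 3.2] -/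
theorem zhangSharpFrameAtThreeHL_of_localGlobal_of_classes_of_oddSelmerRank
    (hLG : ∀ (W : WeierstrassCurve ℚ) [W.IsElliptic] [W.IsGloballyMinimal] [NeZero (W.conductorNorm ℤ)] (K : Type)
      [Field K] [NumberField K] (Dt : ModularParametrizationData W (W.conductorNorm ℤ)) (β : ℤ) (ι : K →+* ℂ),
      Summit.BirchSwinnertonDyer.Rank1Residual.ClassX11b W 3 → W.HasMultiplicativeReductionAtPrime 3 →
      Literature.NumberTheory.EllipticCurves.Rank1Residual.Surj W 3 →
      Literature.NumberTheory.EllipticCurves.Rank1Residual.Ram W 3 → ¬ 3 ∣ W.tamagawaProduct →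
      IsImaginaryQuadratic K → Odd (NumberField.discr K) → SatisfiesHeegnerHypothesis (W.conductorNorm ℤ) K →
      (W.quadraticTwist (NumberField.discr K : ℚ)).entireLFunction 1 ≠ 0 → NumberField.discr K ≠ -3 →
      (4 * (W.conductorNorm ℤ : ℤ)) ∣ β ^ 2 - NumberField.discr K → ¬ (3 : ℤ) ∣ Dt.c →
      ∀ (c : K ≃ₐ[ℚ] K), c ≠ 1 → ∀ [Module (ZMod 3) (V3 W K)],
      -- (Cheb), producing a GOOD prime
      (∀ (n : Finset {q // IsUAdmissiblePrime W K q}) (μ : Bool) (x : V3 W K), GoodLevel W K n →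
        x ∈ SelQ W K c n μ → x ≠ 0 →
        ∃ q : {q // IsUAdmissiblePrime W K q}, q ∉ n ∧ FrobSqNeOneAt W 3 q.1 ∧ ∃ v : HeightOneSpectrum (𝓞 K),
          ((q : ℕ) : 𝓞 K) ∈ v.asIdeal ∧
            (W.baseChange K).torsionLocMap (v.adicCompletion K) ((3 ^ 1 : ℕ) : ℤ) x ≠ 0) ∧
      -- (Equiv), at good primes
      (∀ q : {q // IsUAdmissiblePrime W K q}, FrobSqNeOneAt W 3 q.1 → ∃ s : Bool,
        ∀ v : HeightOneSpectrum (𝓞 K), ((q : ℕ) : 𝓞 K) ∈ v.asIdeal → ∀ z : V3 W K,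
          (W.baseChange K).torsionLocMap (v.adicCompletion K) ((3 ^ 1 : ℕ) : ℤ) (conjAct W c ((3 ^ 1 : ℕ) : ℤ) z) =
            sgn s • (W.baseChange K).torsionLocMap (v.adicCompletion K) ((3 ^ 1 : ℕ) : ℤ) z) ∧
      -- (Line), at good primes
      (∀ (q : {q // IsUAdmissiblePrime W K q}) (v : HeightOneSpectrum (𝓞 K)), FrobSqNeOneAt W 3 q.1 →
        ((q : ℕ) : 𝓞 K) ∈ v.asIdeal →
        ∃ ℓ, ∀ y ∈ selmerLocalKer (W.baseChange K) (v.adicCompletion K) ((3 ^ 1 : ℕ) : ℤ),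
          ∃ a : ℤ, (W.baseChange K).torsionLocMap (v.adicCompletion K) ((3 ^ 1 : ℕ) : ℤ) y = a • ℓ) ∧
      -- (Trans), at good primes
      (∀ (q : {q // IsUAdmissiblePrime W K q}) (v : HeightOneSpectrum (𝓞 K)), FrobSqNeOneAt W 3 q.1 →
        ((q : ℕ) : 𝓞 K) ∈ v.asIdeal →
        ∀ y z : V3 W K, y ∈ selmerLocalKer (W.baseChange K) (v.adicCompletion K) ((3 ^ 1 : ℕ) : ℤ) →
          z ∈ (W.baseChange K).ordinaryLocalKer (v.adicCompletion K) ((3 ^ 1 : ℕ) : ℤ) →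
          (∃ a : ℤ, (W.baseChange K).torsionLocMap (v.adicCompletion K) ((3 ^ 1 : ℕ) : ℤ) z =
            a • (W.baseChange K).torsionLocMap (v.adicCompletion K) ((3 ^ 1 : ℕ) : ℤ) y) →
          (W.baseChange K).torsionLocMap (v.adicCompletion K) ((3 ^ 1 : ℕ) : ℤ) z = 0) ∧
      -- (Iso), on good levels at good primes
      (∀ (n : Finset {q // IsUAdmissiblePrime W K q}) (q : {q // IsUAdmissiblePrime W K q}) (μ : Bool),
        GoodLevel W K n → FrobSqNeOneAt W 3 q.1 → q ∉ n →
        ∀ v : HeightOneSpectrum (𝓞 K), ((q : ℕ) : 𝓞 K) ∈ v.asIdeal →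
        ∀ y ∈ SelRelQ W K c (insert q n) {q} μ, ∀ z ∈ SelRelQ W K c (insert q n) {q} μ,
          (W.baseChange K).torsionLocMap (v.adicCompletion K) ((3 ^ 1 : ℕ) : ℤ) z ≠ 0 →
          ∃ a : ℤ, (W.baseChange K).torsionLocMap (v.adicCompletion K) ((3 ^ 1 : ℕ) : ℤ) y =
            a • (W.baseChange K).torsionLocMap (v.adicCompletion K) ((3 ^ 1 : ℕ) : ℤ) z))
    (hB : ∀ (W : WeierstrassCurve ℚ) [W.IsElliptic] [W.IsGloballyMinimal] [NeZero (W.conductorNorm ℤ)] (K : Type)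
      [Field K] [NumberField K] (Dt : ModularParametrizationData W (W.conductorNorm ℤ)) (β : ℤ) (ι : K →+* ℂ),
      Summit.BirchSwinnertonDyer.Rank1Residual.ClassX11b W 3 → W.HasMultiplicativeReductionAtPrime 3 →
      Literature.NumberTheory.EllipticCurves.Rank1Residual.Surj W 3 →
      Literature.NumberTheory.EllipticCurves.Rank1Residual.Ram W 3 → ¬ 3 ∣ W.tamagawaProduct →
      IsImaginaryQuadratic K → Odd (NumberField.discr K) → SatisfiesHeegnerHypothesis (W.conductorNorm ℤ) K →
      (W.quadraticTwist (NumberField.discr K : ℚ)).entireLFunction 1 ≠ 0 → NumberField.discr K ≠ -3 →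
      (4 * (W.conductorNorm ℤ : ℤ)) ∣ β ^ 2 - NumberField.discr K → ¬ (3 : ℤ) ∣ Dt.c →
      ∀ (c : K ≃ₐ[ℚ] K), c ≠ 1 → ∀ [Module (ZMod 3) (V3 W K)],
      ∃ (κ : {x : (n : ℕ) × KolyvaginHeegnerData Dt β ι n //
              KolyvaginDescent.KolSupp (Zhang2014.IsKolyvaginPrime (W.conductorNorm ℤ) W K 3) x.1} →
            Finset {q // IsUAdmissiblePrime W K q} → V3 W K)
        (m₁ : {x : (n : ℕ) × KolyvaginHeegnerData Dt β ι n //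
              KolyvaginDescent.KolSupp (Zhang2014.IsKolyvaginPrime (W.conductorNorm ℤ) W K 3) x.1}),
        (∀ m, κ m ∅ = m.1.2.kolyvaginClass Nat.prime_three 1) ∧
        (∀ (n : Finset {q // IsUAdmissiblePrime W K q}) (q₁ q₂ : {q // IsUAdmissiblePrime W K q}),
          GoodLevel W K n → GoodLevel W K (insert q₁ n) → GoodLevel W K (insert q₂ (insert q₁ n)) →
          q₁ ∉ n → q₂ ∉ insert q₁ n → q₂ ∉ baseLocusQ W K κ (insert q₂ (insert q₁ n)) → ∃ m, κ m n ≠ 0) ∧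
        (∀ (n : Finset {q // IsUAdmissiblePrime W K q}), GoodLevel W K n → Even n.card → (∃ m, κ m n ≠ 0) →
          ∃ (s : Bool) (d : ℕ), finrank (ZMod 3) (SelQ W K c n s) = d + 1 ∧
            SelQ W K c n s = SelRelQ W K c n (baseLocusQ W K κ n) s ∧
            FiniteDimensional (ZMod 3) (SelRelQ W K c n (baseLocusQ W K κ n) (!s)) ∧
            finrank (ZMod 3) (SelRelQ W K c n (baseLocusQ W K κ n) (!s)) ≤ d) ∧
        (∀ (n : Finset {q // IsUAdmissiblePrime W K q}), GoodLevel W K n → Even n.card →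
          finrank (ZMod 3) (SelQ W K c n true) + finrank (ZMod 3) (SelQ W K c n false) = 1 → κ m₁ n ≠ 0))
    (hPar : ∀ (W : WeierstrassCurve ℚ) [W.IsElliptic] [W.IsGloballyMinimal] [NeZero (W.conductorNorm ℤ)] (K : Type)
      [Field K] [NumberField K] (Dt : ModularParametrizationData W (W.conductorNorm ℤ)) (β : ℤ) (ι : K →+* ℂ),
      Summit.BirchSwinnertonDyer.Rank1Residual.ClassX11b W 3 → W.HasMultiplicativeReductionAtPrime 3 →
      Literature.NumberTheory.EllipticCurves.Rank1Residual.Surj W 3 →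
      Literature.NumberTheory.EllipticCurves.Rank1Residual.Ram W 3 → ¬ 3 ∣ W.tamagawaProduct →
      IsImaginaryQuadratic K → Odd (NumberField.discr K) → SatisfiesHeegnerHypothesis (W.conductorNorm ℤ) K →
      (W.quadraticTwist (NumberField.discr K : ℚ)).entireLFunction 1 ≠ 0 → NumberField.discr K ≠ -3 →
      (4 * (W.conductorNorm ℤ : ℤ)) ∣ β ^ 2 - NumberField.discr K → ¬ (3 : ℤ) ∣ Dt.c →
      ∀ [Module (ZMod 3) (V3 W K)],
      Odd (finrank (ZMod 3) (AddSubgroup.toZModSubmodule 3 (selmerGroup (W.baseChange K) ((3 ^ 1 : ℕ) : ℤ))))) :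
    Summit.BirchSwinnertonDyer.BirchSwinnertonDyer.Theses.KolyvaginRoadThree.ZhangSharpFrameAtThreeHL :=
  zhangSharpFrameAtThreeHL_of_rankLowering_of_classes_of_oddSelmerRank
    (fun W _ _ _ K _ _ Dt β ι hX hmult hsurj hram htam hK hodd hH hLt h3 hβ hc c hc1 _ ↦ by
      obtain ⟨hcheb, hequiv, hline, htrans, hiso⟩ :=
        hLG W K Dt β ι hX hmult hsurj hram htam hK hodd hH hLt h3 hβ hc c hc1
      exact selQ_rankLowering_on_of_localGlobal W K c hcheb hequiv hline htrans hiso)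
    hB hPar

end Summit.BirchSwinnertonDyer.Rank1Residual.X11b.Three.Koly.Method2

end
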